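import Mathlib
import HarnessLib
import Summits.BirchSwinnertonDyer.BirchSwinnertonDyer.Theorems.SylvesterTwoHeegnerIndexUnramifiedQuadraticPairings

/-!
# Route `SylvesterTwoHeegnerIndex` (rung K7t): the `ℤ₂[ω]`-linear algebra of ROAD (k), PART III —
# `2`-adic ORDERS on a cyclic `𝒪/2^N`-line and the ORDER DISCIPLINE of an `𝒪`-balanced pairing

Cell `bsd-cm`, seat `bsd-cm-k7t-c2` (prover-bsd-cm-k7t-c2-g15-0; hand item 19229
`HeegnerIndexUpperAtTwoHSY`: verdict unchanged, NOT FOUND as a theorem — fact-free, equivalent modulo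
the route's facts to `MissingUpperBoundAt B 2`, open as a class). PARTITION (D-0054): CornerF at `p = 2`
(B14/O12) × 𝒞_HSY (`E_p : x³ + y³ = p`) × `p = 2` — types-the-object-of: the order bookkeeping of the
`𝒪`-linear Kolyvagin argument over the CM field `K = ℚ(ω)` at the inert prime `2` (ROAD (k): line card
`Cruxes/UpperOffV0HSYPlus/Lines/cmframe-kolyvagin2.md`, skeleton of record VARIANT J
`Cruxes/UpperOffV0HSYPlus/Lines/coupled_variantJ.lean`, stubs (K3-4)/(K3-7) = THEOREM K3 / K3* typed),
continuing Part I (`…UnramifiedQuadraticDescent`, p553247, LEMMA D ≡ K0) and Part II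
(`…UnramifiedQuadraticPairings`, p571041). Kernel helper `--supports stmt-BirchSwinnertonDyer-19804
--as helper`; closes no cell and no item; BSD is not claimed; THEOREM K3 stays a PAPER theorem (memo two
v2.18 §64–§66, refereed g61) — nothing below is an Euler-system statement. Everything is PROVED
abstract algebra over Mathlib: no definition, no named fact, no instance, no notation, no `sorry`.

SETTING (as in Parts I/II): an additive group `M` with `w : M →+ M`, `w² + w + 1 = 0` (a
`ℤ[ω]`-module); «`z₀` is an `𝒪`-GENERATOR» is DISPLAYED as `∀ x, ∃ m n : ℤ, x = m • z₀ + n • w z₀`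
(never defined); a CYCLIC `𝒪/2^N`-LINE has a generator `e` with `2^N e = 0`, `2^k e = 0 → N ≤ k`.

WHAT IS PROVED, AND WHERE ROAD (k) USES IT (memo two = `HOME/MEMO-bsd-cm-two.md` v2.20 §64–§65;
[McC91] = W. G. McCallum, *Kolyvagin's work on Shafarevich–Tate groups*, LMS LN 153 (1991), §5).
* §A UNITS OF `𝒪/2^N` in the encoding: the norm identity `(m − n)·x − n·ωx = (m² − mn + n²)·e` for
  `x = m e + n ωe`; `m² − mn + n²` is ODD iff `m, n` are not both even; hence a scalar `m + nω ∉ 2𝒪`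
  is a unit modulo `2^N`: `e ∈ 𝒪·x` (`generator_of_not_two_dvd`). USE: memo §64.0 «in `O/2^N` the
  elements of additive order `2^N` are exactly the units times a generator» — the dictionary that
  turns every «element of order `p^N`» of [McC91] into «`𝒪`-generator».
* §B ORDERS ON A CYCLIC LINE: every `z` is `2^a • z₀` with `z₀` a generator; generators are killed by
  `2^k` iff `N ≤ k`, and are exactly the non-`2`-divisible elements (`N ≥ 1`);
  `addOrderOf (2^a • z₀) = 2^(N − a)`; FREENESS `m e + n ωe = 0 ↔ 2^N ∣ m ∧ 2^N ∣ n` (the line is free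
  of rank one over `𝒪/2^N`). USE: memo §64.1 (P6) «`X(K_λ)/2^M ≅ H¹(K_λ, X)[2^M] ≅ O/2^M` free of
  rank 1»; §65.3 (c) 1 «the non-`2`-divisible `Q_n` `O`-generates `E(K_{λ′})/2^{L*}`, so
  `P_n = 2^{M_r} Q_n` has order `2^{L* − M_r}`».
* §C THE ORDER DISCIPLINE for a biadditive `B : D × Y → Q` between two `𝒪`-modules, `𝒪`-BALANCED
  (`B(ωd, y) = B(d, ω̄y)`) and non-degenerate on one side (in Part II's display `((d, y)) = 0 ↔
  B(d, y) = 0 ∧ B(ωd, y) = 0`, `refine_eq_zero_iff`): `y₀` a generator ⇒ (`((d, y₀)) = 0 ⇒ d = 0`);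
  `d₀` of exact order `2^N`, `2^N y₀ = 0` ⇒ (`((2^a d₀, 2^b y₀)) = 0 ↔ N ≤ a + b`); between two cyclic
  `𝒪/2^N`-lines LITERALLY «`((d, y)) = 0 ↔ ord d · ord y ≤ 2^N`» (`pairing_eq_zero_iff_mul_addOrderOf_le`).
  USE: memo §64.1 (P6) = [McC91 p. 288] «two elements pair non-trivially if … their orders multiply to
  more than `p^M`» (with «same eigenspace» ↦ «same curve», `⟨ , ⟩ ↦ (( , ))`), FALSE at `p = 2` for
  the `ℚ/ℤ`-valued pairing (`Tr(1/2) ≡ 0`) — hence the refinement: STEP `i = 1` of §64.5 ((16′)+(17′))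
  and the deep-prime `λ′`-term of §65.3 (orders `2^{L* − M_r}`, `2^{M_r + 1}`: product `2^{L*+1}`),
  the step where the PRINTED [McC91 Prop 5.2] fails for `M_r ≥ 1` (referee g61
  `referee/REFEREE-ROADK-K3-G61.md` §3) and where the memo's repair lives (§4 (c) 3 ibid.).
-/

set_option autoImplicit false
set_option linter.dupNamespace false

namespace Summit.BirchSwinnertonDyer.BirchSwinnertonDyer.Theorems.SylvesterTwoUnramifiedOrders

open Summit.BirchSwinnertonDyer.BirchSwinnertonDyer.Theorems.SylvesterTwoUnramifiedPairings

variable {M : Type*} [AddCommGroup M]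

/-! ### §A Units of `𝒪/2^N`: the norm form `m² − mn + n²` -/

/-- NORM IDENTITY: for `x = m e + n ωe`, `(m − n)·x − n·ωx = (m² − mn + n²)·e`
(`(m + nω̄)(m + nω) = m² − mn + n²`). -/
theorem norm_smul_eq (w : M →+ M) (hw : ∀ x, w (w x) + w x + x = 0) (e : M) (m n : ℤ) :
    (m - n) • (m • e + n • w e) - n • w (m • e + n • w e) = (m ^ 2 - m * n + n ^ 2) • e := by
  simp only [map_add, map_zsmul, w_w_eq w hw]
  module

/-- PARITY OF THE NORM FORM: `m² − mn + n²` is odd iff `m, n` are not both even (`𝒪/2 = 𝔽₄` is a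
field: every element of `𝒪 ∖ 2𝒪` has odd norm). -/
theorem odd_norm_iff (m n : ℤ) : Odd (m ^ 2 - m * n + n ^ 2) ↔ ¬ (2 ∣ m ∧ 2 ∣ n) := by
  rcases Int.even_or_odd m with ⟨a, rfl⟩ | ⟨a, rfl⟩ <;>
    rcases Int.even_or_odd n with ⟨b, rfl⟩ | ⟨b, rfl⟩
  · refine iff_of_false ?_ (fun h => h ⟨⟨a, by ring⟩, ⟨b, by ring⟩⟩)
    rw [Int.not_odd_iff_even]
    exact ⟨2 * a ^ 2 - 2 * a * b + 2 * b ^ 2, by ring⟩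
  · exact iff_of_true ⟨2 * a ^ 2 - 2 * a * b - a + 2 * b ^ 2 + 2 * b, by ring⟩
      (by rintro ⟨-, h2⟩; omega)
  · exact iff_of_true ⟨2 * a ^ 2 + 2 * a - 2 * a * b - b + 2 * b ^ 2, by ring⟩
      (by rintro ⟨h1, -⟩; omega)
  · exact iff_of_true ⟨2 * a ^ 2 + a - 2 * a * b + b + 2 * b ^ 2, by ring⟩
      (by rintro ⟨h1, -⟩; omega)

/-- INVERSION OF A NON-`2`-DIVISIBLE SCALAR: if `2^N e = 0` and `x = m e + n ωe` with `m, n` not both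
even, then `e ∈ 𝒪·x` — `m + nω` is a unit of `𝒪/2^N` (its norm is odd, hence invertible mod `2^N`).
[memo §64.0: «elements of additive order `2^N` = units × generator».] -/
theorem generator_of_not_two_dvd (w : M →+ M) (hw : ∀ x, w (w x) + w x + x = 0) {N : ℕ} {e : M}
    (hN : (2 : ℤ) ^ N • e = 0) {m n : ℤ} (hmn : ¬ (2 ∣ m ∧ 2 ∣ n)) :
    ∃ m' n' : ℤ, e = m' • (m • e + n • w e) + n' • w (m • e + n • w e) := by
  obtain ⟨k, hk⟩ := (odd_norm_iff m n).mpr hmn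
  have hcop : IsCoprime (m ^ 2 - m * n + n ^ 2) ((2 : ℤ) ^ N) := by
    apply IsCoprime.pow_right
    exact ⟨1, -k, by rw [hk]; ring⟩
  obtain ⟨u, v, huv⟩ := hcop
  refine ⟨u * (m - n), -(u * n), ?_⟩
  have h1 : e = u • ((m ^ 2 - m * n + n ^ 2) • e) + v • ((2 : ℤ) ^ N • e) := by
    rw [smul_smul, smul_smul, ← add_smul, huv, one_smul]
  rw [hN, smul_zero, add_zero, ← norm_smul_eq w hw e m n, smul_sub, smul_smul, smul_smul] at h1
  rw [neg_smul, ← sub_eq_add_neg]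
  exact h1

/-- SPANS COMPOSE: `e = m′x + n′ωx`, `z = m e + n ωe ⇒ z = (mm′ − nn′)x + (mn′ + nm′ − nn′)ωx`. -/
theorem span_trans (w : M →+ M) (hw : ∀ x, w (w x) + w x + x = 0) {x e z : M} {m' n' m n : ℤ}
    (he : e = m' • x + n' • w x) (hz : z = m • e + n • w e) :
    z = (m * m' - n * n') • x + (m * n' + n * m' - n * n') • w x := by
  subst hz
  subst he
  simp only [map_add, map_zsmul, w_w_eq w hw]
  module

/-- `2`-ADIC VALUATION OF A PAIR: `(m, n) ≠ (0, 0)` is `2^a·(m₀, n₀)` with `m₀, n₀` not both even. -/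
theorem exists_two_pow_mul_not_both_even (m n : ℤ) (h : m ≠ 0 ∨ n ≠ 0) :
    ∃ (a : ℕ) (m₀ n₀ : ℤ), ¬ (2 ∣ m₀ ∧ 2 ∣ n₀) ∧ m = 2 ^ a * m₀ ∧ n = 2 ^ a * n₀ := by
  suffices H : ∀ k : ℕ, ∀ m n : ℤ, m.natAbs + n.natAbs ≤ k → (m ≠ 0 ∨ n ≠ 0) →
      ∃ (a : ℕ) (m₀ n₀ : ℤ), ¬ (2 ∣ m₀ ∧ 2 ∣ n₀) ∧ m = 2 ^ a * m₀ ∧ n = 2 ^ a * n₀ from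
    H _ m n le_rfl h
  intro k
  induction k with
  | zero =>
    intro m n hk hmn
    exact absurd hmn (by simp [Int.natAbs_eq_zero.mp (show m.natAbs = 0 by omega),
      Int.natAbs_eq_zero.mp (show n.natAbs = 0 by omega)])
  | succ k ih =>
    intro m n hk hmn
    by_cases h2 : 2 ∣ m ∧ 2 ∣ n
    · obtain ⟨⟨m', rfl⟩, ⟨n', rfl⟩⟩ := h2
      have hmn' : m' ≠ 0 ∨ n' ≠ 0 := hmn.imp (fun h h' => h (by rw [h', mul_zero]))
        (fun h h' => h (by rw [h', mul_zero]))
      have hk' : m'.natAbs + n'.natAbs ≤ k := by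
        rw [Int.natAbs_mul, Int.natAbs_mul, show (2 : ℤ).natAbs = 2 from rfl] at hk
        rcases hmn' with h | h
        · have := Int.natAbs_pos.mpr h; omega
        · have := Int.natAbs_pos.mpr h; omega
      obtain ⟨a, m₀, n₀, h0, rfl, rfl⟩ := ih m' n' hk' hmn'
      exact ⟨a + 1, m₀, n₀, h0, by ring, by ring⟩
    · exact ⟨0, m, n, h2, by ring, by ring⟩

/-! ### §B Orders on a cyclic `𝒪/2^N`-line -/

/-- A cyclic line with `2^N e = 0` is killed by `2^N`. -/
theorem two_pow_smul_eq_zero_of_generator (w : M →+ M) {N : ℕ} {e : M}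
    (he : ∀ x : M, ∃ m n : ℤ, x = m • e + n • w e) (hN : (2 : ℤ) ^ N • e = 0) (z : M) :
    (2 : ℤ) ^ N • z = 0 := by
  obtain ⟨m, n, rfl⟩ := he z
  rw [smul_add, smul_comm _ m, smul_comm _ n, ← map_zsmul w ((2 : ℤ) ^ N), hN, map_zero,
    smul_zero, smul_zero, add_zero]

/-- VALUATION: on a cyclic line with `2^N e = 0`, every element is `2^a • z₀` for a GENERATOR `z₀`
(the zero element as `2^N • e`). [memo §64.0 / (P6): «write `d = 2^a u e` with `u` a unit».] -/
theorem exists_two_pow_smul_generator (w : M →+ M) (hw : ∀ x, w (w x) + w x + x = 0) {N : ℕ} {e : M}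
    (he : ∀ x : M, ∃ m n : ℤ, x = m • e + n • w e) (hN : (2 : ℤ) ^ N • e = 0) (z : M) :
    ∃ (a : ℕ) (z₀ : M), (∀ x : M, ∃ m n : ℤ, x = m • z₀ + n • w z₀) ∧ z = (2 : ℤ) ^ a • z₀ := by
  obtain ⟨m, n, hz⟩ := he z
  by_cases h0 : m = 0 ∧ n = 0
  · refine ⟨N, e, he, ?_⟩
    rw [hz, h0.1, h0.2, zero_smul, zero_smul, add_zero, hN]
  · have hmn : m ≠ 0 ∨ n ≠ 0 := by
      by_cases hm : m = 0
      · exact Or.inr fun hn => h0 ⟨hm, hn⟩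
      · exact Or.inl hm
    obtain ⟨a, m₀, n₀, hodd, rfl, rfl⟩ := exists_two_pow_mul_not_both_even m n hmn
    obtain ⟨m', n', he'⟩ := generator_of_not_two_dvd w hw hN hodd
    refine ⟨a, m₀ • e + n₀ • w e, ?_, ?_⟩
    · intro x
      obtain ⟨m₁, n₁, hx⟩ := he x
      exact ⟨_, _, span_trans w hw he' hx⟩
    · rw [hz, mul_smul, mul_smul, smul_add]

/-- GENERATORS HAVE EXACT ORDER `2^N`: if `e` generates, `2^N e = 0`, no smaller power kills `e`,
and `e ∈ 𝒪·z₀`, then `2^k • z₀ = 0 ↔ N ≤ k`. -/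
theorem two_pow_smul_eq_zero_iff_of_generator (w : M →+ M) {N : ℕ} {e : M}
    (he : ∀ x : M, ∃ m n : ℤ, x = m • e + n • w e) (hN : (2 : ℤ) ^ N • e = 0)
    (hmin : ∀ k : ℕ, (2 : ℤ) ^ k • e = 0 → N ≤ k) {z₀ : M}
    (hz₀ : ∃ m n : ℤ, e = m • z₀ + n • w z₀) (k : ℕ) :
    (2 : ℤ) ^ k • z₀ = 0 ↔ N ≤ k := by
  constructor
  · intro hk
    apply hmin k
    obtain ⟨m, n, rfl⟩ := hz₀
    rw [smul_add, smul_comm _ m, smul_comm _ n, ← map_zsmul w ((2 : ℤ) ^ k), hk, map_zero,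
      smul_zero, smul_zero, add_zero]
  · intro hk
    obtain ⟨c, rfl⟩ := Nat.exists_eq_add_of_le hk
    rw [pow_add, mul_comm, mul_smul, two_pow_smul_eq_zero_of_generator w he hN z₀, smul_zero]

/-- GENERATORS = NON-`2`-DIVISIBLE ELEMENTS (`N ≥ 1`): `z₀` generates the line iff `z₀ ∉ 2M`.
[memo §65.3 (c) 1: «the non-`2`-divisible `Q_n` `O`-generates `E(K_{λ′})/2^{L*}`».] -/
theorem generator_iff_not_two_dvd (w : M →+ M) (hw : ∀ x, w (w x) + w x + x = 0) {N : ℕ} {e : M}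
    (he : ∀ x : M, ∃ m n : ℤ, x = m • e + n • w e) (hN : (2 : ℤ) ^ N • e = 0)
    (hmin : ∀ k : ℕ, (2 : ℤ) ^ k • e = 0 → N ≤ k) (hN1 : 1 ≤ N) (z₀ : M) :
    (∀ x : M, ∃ m n : ℤ, x = m • z₀ + n • w z₀) ↔ ¬ ∃ y : M, z₀ = (2 : ℤ) • y := by
  constructor
  · rintro hgen ⟨y, rfl⟩
    -- `e ∈ 𝒪·(2y) = 2·𝒪·y`, so `2^(N-1) e = 0`, contradicting minimality
    obtain ⟨m, n, he'⟩ := hgen e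
    have hkill : (2 : ℤ) ^ (N - 1) • e = 0 := by
      have h2 : (2 : ℤ) ^ (N - 1) * 2 = (2 : ℤ) ^ N := by
        rw [← pow_succ, Nat.sub_add_cancel hN1]
      have h2y : (2 : ℤ) ^ (N - 1) • (2 : ℤ) • y = 0 := by
        rw [smul_smul, h2, two_pow_smul_eq_zero_of_generator w he hN y]
      rw [he', smul_add, smul_comm _ m, smul_comm _ n, ← map_zsmul w ((2 : ℤ) ^ (N - 1)), h2y,
        map_zero, smul_zero, smul_zero, add_zero]
    have := hmin (N - 1) hkill
    omega
  · intro hndvd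
    obtain ⟨a, z₁, hz₁, hz⟩ := exists_two_pow_smul_generator w hw he hN z₀
    rcases Nat.eq_zero_or_pos a with ha | ha
    · rw [ha, pow_zero, one_smul] at hz
      rw [hz]
      exact hz₁
    · exfalso
      apply hndvd
      refine ⟨(2 : ℤ) ^ (a - 1) • z₁, ?_⟩
      rw [hz, smul_smul, ← pow_succ', Nat.sub_add_cancel ha]

/-- ORDER FORMULA: on a cyclic `𝒪/2^N`-line, `addOrderOf (2^a • z₀) = 2^(N − a)` for a generator
`z₀` (truncated subtraction: for `a ≥ N` the element is `0`, of order `1`). [memo §64.0/(P6): «`ord d =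
2^{N − a}` for `d = 2^a u e`».] -/
theorem addOrderOf_two_pow_smul_generator (w : M →+ M) {N : ℕ} {e : M}
    (he : ∀ x : M, ∃ m n : ℤ, x = m • e + n • w e) (hN : (2 : ℤ) ^ N • e = 0)
    (hmin : ∀ k : ℕ, (2 : ℤ) ^ k • e = 0 → N ≤ k) {z₀ : M}
    (hz₀ : ∃ m n : ℤ, e = m • z₀ + n • w z₀) (a : ℕ) :
    addOrderOf ((2 : ℤ) ^ a • z₀) = 2 ^ (N - a) := by
  have key := two_pow_smul_eq_zero_iff_of_generator w he hN hmin hz₀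
  -- `ℕ`-scalar form of the powers of `2`
  have cast : ∀ (k : ℕ) (x : M), 2 ^ k • x = (2 : ℤ) ^ k • x := by
    intro k x
    rw [← natCast_zsmul]
    push_cast
    rfl
  rcases Nat.lt_or_ge a N with hlt | hge
  · obtain ⟨c, hc⟩ := Nat.exists_eq_add_of_lt hlt
    have hNa : N - a = c + 1 := by omega
    rw [hNa]
    haveI : Fact (Nat.Prime 2) := Nat.fact_prime_two
    refine addOrderOf_eq_prime_pow ?_ ?_
    · rw [cast, smul_smul, ← pow_add, key]
      omega
    · rw [cast, smul_smul, ← pow_add, key]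
      omega
  · rw [(key a).mpr hge, addOrderOf_zero, Nat.sub_eq_zero_of_le hge, pow_zero]

/-- FREENESS: a cyclic `𝒪/2^N`-line is FREE of rank one over `𝒪/2^N` —
`m e + n ωe = 0 ↔ 2^N ∣ m ∧ 2^N ∣ n`. [memo §64.1 (P6) «`≅ O/2^M` free of rank 1».] -/
theorem smul_add_smul_w_eq_zero_iff (w : M →+ M) (hw : ∀ x, w (w x) + w x + x = 0) {N : ℕ} {e : M}
    (he : ∀ x : M, ∃ m n : ℤ, x = m • e + n • w e) (hN : (2 : ℤ) ^ N • e = 0)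
    (hmin : ∀ k : ℕ, (2 : ℤ) ^ k • e = 0 → N ≤ k) (m n : ℤ) :
    m • e + n • w e = 0 ↔ (2 : ℤ) ^ N ∣ m ∧ (2 : ℤ) ^ N ∣ n := by
  constructor
  · intro h0
    by_cases hmn : m = 0 ∧ n = 0
    · rw [hmn.1, hmn.2]; exact ⟨dvd_zero _, dvd_zero _⟩
    · have hmn' : m ≠ 0 ∨ n ≠ 0 := by
        by_cases hm : m = 0
        · exact Or.inr fun hn => hmn ⟨hm, hn⟩
        · exact Or.inl hm
      obtain ⟨a, m₀, n₀, hodd, rfl, rfl⟩ := exists_two_pow_mul_not_both_even m n hmn'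
      obtain ⟨m', n', he'⟩ := generator_of_not_two_dvd w hw hN hodd
      rw [mul_smul, mul_smul, ← smul_add] at h0
      have hle : N ≤ a :=
        (two_pow_smul_eq_zero_iff_of_generator w he hN hmin ⟨m', n', he'⟩ a).mp h0
      obtain ⟨c, rfl⟩ := Nat.exists_eq_add_of_le hle
      exact ⟨⟨2 ^ c * m₀, by ring⟩, ⟨2 ^ c * n₀, by ring⟩⟩
  · rintro ⟨⟨m₁, rfl⟩, ⟨n₁, rfl⟩⟩
    rw [mul_comm _ m₁, mul_comm _ n₁, mul_smul, mul_smul, ← map_zsmul w, hN, map_zero, smul_zero,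
      smul_zero, add_zero]

/-! ### §C The ORDER DISCIPLINE of an `𝒪`-balanced pairing between two `𝒪`-modules
`B : D →+ Y →+ Q` with `B (w_D d) y = B d (w̄_Y y)`, `w̄ = −1 − w` (local Tate duality pairs two
DIFFERENT groups, `H¹(K_λ, X)[2^M]` and `X(K_λ)/2^M`; in Part II's display
`((d, y)) = 0 ↔ B d y = 0 ∧ B (w_D d) y = 0`, `refine_eq_zero_iff`). -/

section Pairing
variable {D Y Q : Type*} [AddCommGroup D] [AddCommGroup Y] [AddCommGroup Q]

/-- Balancedness moves `ω` to the right argument: `B(d, ωy) = −B(d, y) − B(ωd, y)`. -/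
theorem pairing_right_w₂ (wD : D →+ D) (wY : Y →+ Y) (B : D →+ Y →+ Q)
    (hB : ∀ d y, B (wD d) y = B d (-y - wY y)) (d : D) (y : Y) :
    B d (wY y) = -(B d y) - B (wD d) y := by
  have h := hB d y
  rw [map_sub, map_neg] at h
  rw [h]; abel

/-- Scalars move through both arguments: `B (2^a • d) (2^b • y) = B (2^(a+b) • d) y`. -/
theorem pairing_two_pow_two_pow (B : D →+ Y →+ Q) (d : D) (y : Y) (a b : ℕ) :
    B ((2 : ℤ) ^ a • d) ((2 : ℤ) ^ b • y) = B ((2 : ℤ) ^ (a + b) • d) y := by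
  rw [map_zsmul (B ((2 : ℤ) ^ a • d)), map_zsmul B ((2 : ℤ) ^ a) d, map_zsmul B ((2 : ℤ) ^ (a + b)) d,
    AddMonoidHom.zsmul_apply, AddMonoidHom.zsmul_apply, smul_smul, ← pow_add, add_comm]

/-- GENERATOR FORM (left): if `B` is balanced with trivial LEFT kernel and `y₀` is an `𝒪`-generator of
`Y`, then `((d, y₀)) = 0 ⇒ d = 0`. [memo §64.5 STEP `i = 1`, (17′)+(P6): «`y_{1,λ₁}` generates
`A(K_{λ₁})/2^{N₁}`, so the pairing with any non-zero `d` is non-zero».] -/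
theorem eq_zero_of_pairing_generator_eq_zero (wD : D →+ D) (wY : Y →+ Y) (B : D →+ Y →+ Q)
    (hB : ∀ d y, B (wD d) y = B d (-y - wY y)) (hnd : ∀ d : D, (∀ y : Y, B d y = 0) → d = 0)
    {y₀ : Y} (hy₀ : ∀ y : Y, ∃ m n : ℤ, y = m • y₀ + n • wY y₀) {d : D}
    (h1 : B d y₀ = 0) (h2 : B (wD d) y₀ = 0) : d = 0 := by
  apply hnd d
  intro y
  obtain ⟨m, n, rfl⟩ := hy₀ y
  rw [map_add, map_zsmul, map_zsmul, pairing_right_w₂ wD wY B hB, h1, h2]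
  simp

/-- GENERATOR FORM (right): trivial RIGHT kernel, `d₀` an `𝒪`-generator: `((d₀, y)) = 0 ⇒ y = 0`. -/
theorem eq_zero_of_generator_pairing_eq_zero (wD : D →+ D) (B : D →+ Y →+ Q)
    (hnd : ∀ y : Y, (∀ d : D, B d y = 0) → y = 0)
    {d₀ : D} (hd₀ : ∀ d : D, ∃ m n : ℤ, d = m • d₀ + n • wD d₀) {y : Y}
    (h1 : B d₀ y = 0) (h2 : B (wD d₀) y = 0) : y = 0 := by
  apply hnd y
  intro d
  obtain ⟨m, n, rfl⟩ := hd₀ d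
  rw [map_add, map_zsmul, map_zsmul, AddMonoidHom.add_apply, AddMonoidHom.zsmul_apply,
    AddMonoidHom.zsmul_apply, h1, h2, smul_zero, smul_zero, add_zero]

/-- **THE ORDER DISCIPLINE (valuation form, left).** `B` balanced with trivial left kernel; `y₀` an
`𝒪`-generator of `Y` with `2^N y₀ = 0`; `d₀ ∈ D` of exact order `2^N` (`2^k d₀ = 0 → N ≤ k`). Then
`((2^a d₀, 2^b y₀)) = 0 ↔ N ≤ a + b`. [memo §64.1 (P6): «write `d = 2^a u e`, `y = 2^b u′ f`;
`((e, f))` generates `2^{−M}O/O`; `2^{a+b}·unit ≠ 0` there iff `a + b < M`»; §65.3 (c) 3: orders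
`2^{L* − M_r}` and `2^{M_r + 1}`, i.e. `a = M_r`, `b = L* − M_r − 1`, `a + b = L* − 1 < L*`.] -/
theorem pairing_two_pow_eq_zero_iff (wD : D →+ D) (wY : Y →+ Y) (B : D →+ Y →+ Q)
    (hB : ∀ d y, B (wD d) y = B d (-y - wY y)) (hnd : ∀ d : D, (∀ y : Y, B d y = 0) → d = 0)
    {N : ℕ} {y₀ : Y} (hy₀ : ∀ y : Y, ∃ m n : ℤ, y = m • y₀ + n • wY y₀)
    (hNy : (2 : ℤ) ^ N • y₀ = 0) {d₀ : D} (hmin : ∀ k : ℕ, (2 : ℤ) ^ k • d₀ = 0 → N ≤ k) (a b : ℕ) :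
    (B ((2 : ℤ) ^ a • d₀) ((2 : ℤ) ^ b • y₀) = 0 ∧
      B (wD ((2 : ℤ) ^ a • d₀)) ((2 : ℤ) ^ b • y₀) = 0) ↔ N ≤ a + b := by
  rw [map_zsmul wD, pairing_two_pow_two_pow, pairing_two_pow_two_pow, ← map_zsmul wD]
  constructor
  · rintro ⟨h1, h2⟩
    exact hmin (a + b) (eq_zero_of_pairing_generator_eq_zero wD wY B hB hnd hy₀ h1 h2)
  · intro hle
    obtain ⟨c, hc⟩ := Nat.exists_eq_add_of_le hle
    have hy : ∀ x : D, B ((2 : ℤ) ^ (a + b) • x) y₀ = 0 := by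
      intro x
      rw [← zero_add (a + b), ← pairing_two_pow_two_pow, pow_zero, one_smul, hc, pow_add,
        mul_comm ((2 : ℤ) ^ N), mul_smul, hNy, smul_zero, map_zero]
    exact ⟨hy d₀, by rw [map_zsmul wD]; exact hy (wD d₀)⟩

/-- **THE ORDER DISCIPLINE (valuation form, right).** Trivial right kernel; `d₀` an `𝒪`-generator of
`D` with `2^N d₀ = 0`; `y₀ ∈ Y` of exact order `2^N`. Then `((2^a d₀, 2^b y₀)) = 0 ↔ N ≤ a + b`. -/
theorem pairing_two_pow_eq_zero_iff' (wD : D →+ D) (B : D →+ Y →+ Q)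
    (hnd : ∀ y : Y, (∀ d : D, B d y = 0) → y = 0)
    {N : ℕ} {d₀ : D} (hd₀ : ∀ d : D, ∃ m n : ℤ, d = m • d₀ + n • wD d₀)
    (hNd : (2 : ℤ) ^ N • d₀ = 0) {y₀ : Y} (hmin : ∀ k : ℕ, (2 : ℤ) ^ k • y₀ = 0 → N ≤ k) (a b : ℕ) :
    (B ((2 : ℤ) ^ a • d₀) ((2 : ℤ) ^ b • y₀) = 0 ∧
      B (wD ((2 : ℤ) ^ a • d₀)) ((2 : ℤ) ^ b • y₀) = 0) ↔ N ≤ a + b := by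
  -- move all scalars onto `y₀`
  have flip : ∀ (x : D), B ((2 : ℤ) ^ a • x) ((2 : ℤ) ^ b • y₀) = B x ((2 : ℤ) ^ (a + b) • y₀) := by
    intro x
    rw [pairing_two_pow_two_pow, ← zero_add (a + b), ← pairing_two_pow_two_pow, pow_zero, one_smul,
      zero_add]
  rw [map_zsmul wD, flip, flip]
  constructor
  · rintro ⟨h1, h2⟩
    exact hmin (a + b) (eq_zero_of_generator_pairing_eq_zero wD B hnd hd₀ h1 h2)
  · intro hle
    obtain ⟨c, hc⟩ := Nat.exists_eq_add_of_le hle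
    have hkill : (2 : ℤ) ^ (a + b) • y₀ = 0 := by
      -- `2^N y₀ = 0` via the trivial right kernel: `B d (2^N y₀) = B (2^N d) y₀ = 0` for all `d`
      have hN0 : (2 : ℤ) ^ N • y₀ = 0 := by
        apply hnd
        intro d
        rw [map_zsmul (B d), ← AddMonoidHom.zsmul_apply, ← map_zsmul B,
          two_pow_smul_eq_zero_of_generator wD hd₀ hNd d, map_zero, AddMonoidHom.zero_apply]
      rw [hc, pow_add, mul_comm ((2 : ℤ) ^ N), mul_smul, hN0, smul_zero]
    refine ⟨by rw [hkill, map_zero], by rw [hkill, map_zero]⟩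

/-- **THE ORDER DISCIPLINE IN McCALLUM'S WORDS.** Between two cyclic `𝒪/2^N`-lines `D = 𝒪e_D`,
`Y = 𝒪e_Y` (generators of exact order `2^N`) under an `𝒪`-balanced pairing `B` with trivial left
kernel: for ALL `d ∈ D`, `y ∈ Y`, `((d, y)) = 0 ↔ ord d · ord y ≤ 2^N`; equivalently `((d, y)) ≠ 0`
whenever `ord d · ord y > 2^N`. [= [McC91 p. 288] «two elements pair non-trivially if they are in the
same eigenspace and their orders multiply to more than `p^M`» with «same eigenspace» ↦ «same curve»,
`⟨ , ⟩ ↦ (( , ))` — memo §64.1 (P6); used by STEP `i = 1` (§64.5) and the deep-prime `λ′`-term (§65.3).]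
`((d, y)) = 0` is the CONJUNCTION `B d y = 0 ∧ B (ωd) y = 0` (Part II `refine_eq_zero_iff`); for the
trace-valued `B` ALONE the sentence is FALSE at `p = 2` — counterexample shape: on the line `𝒪/2 = 𝔽₄`
with `B(x, y) = Tr(xȳ) mod 2`, `B(1, 1) = Tr 1 = 2 ≡ 0` although `ord 1 · ord 1 = 4 > 2`, while
`B(ω, 1) = Tr ω = −1 ≢ 0`; this is the «`Tr(1/2) ≡ 0`» of memo §64.1 (P6) and the unit device
`[u] ∈ μ₃` of §64.4 (13) / referee g61 §4 (c) 3. -/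
theorem pairing_eq_zero_iff_mul_addOrderOf_le (wD : D →+ D) (wY : Y →+ Y)
    (hwD : ∀ x, wD (wD x) + wD x + x = 0) (hwY : ∀ y, wY (wY y) + wY y + y = 0) (B : D →+ Y →+ Q)
    (hB : ∀ d y, B (wD d) y = B d (-y - wY y)) (hnd : ∀ d : D, (∀ y : Y, B d y = 0) → d = 0)
    {N : ℕ} {eD : D} (heD : ∀ x : D, ∃ m n : ℤ, x = m • eD + n • wD eD) (hND : (2 : ℤ) ^ N • eD = 0)
    (hminD : ∀ k : ℕ, (2 : ℤ) ^ k • eD = 0 → N ≤ k)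
    {eY : Y} (heY : ∀ y : Y, ∃ m n : ℤ, y = m • eY + n • wY eY) (hNY : (2 : ℤ) ^ N • eY = 0)
    (hminY : ∀ k : ℕ, (2 : ℤ) ^ k • eY = 0 → N ≤ k) (d : D) (y : Y) :
    (B d y = 0 ∧ B (wD d) y = 0) ↔ addOrderOf d * addOrderOf y ≤ 2 ^ N := by
  obtain ⟨a, d₀, hd₀, rfl⟩ := exists_two_pow_smul_generator wD hwD heD hND d
  obtain ⟨b, y₀, hy₀, rfl⟩ := exists_two_pow_smul_generator wY hwY heY hNY y
  obtain ⟨md, nd, hed⟩ := hd₀ eD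
  obtain ⟨my, ny, hey⟩ := hy₀ eY
  rw [addOrderOf_two_pow_smul_generator wD heD hND hminD ⟨md, nd, hed⟩,
    addOrderOf_two_pow_smul_generator wY heY hNY hminY ⟨my, ny, hey⟩, ← pow_add,
    Nat.pow_le_pow_iff_right (by norm_num : 1 < 2),
    pairing_two_pow_eq_zero_iff wD wY B hB hnd hy₀ (two_pow_smul_eq_zero_of_generator wY heY hNY y₀)
      (fun k hk => (two_pow_smul_eq_zero_iff_of_generator wD heD hND hminD ⟨md, nd, hed⟩ k).mp hk)]
  omega

end Pairing

end Summit.BirchSwinnertonDyer.BirchSwinnertonDyer.Theorems.SylvesterTwoUnramifiedOrders
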